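import Summits.QuantumFields.QCD.Theses.NestedDissectionSea
import Literature.MathematicalPhysics.QuantumFieldTheory.QCDPhaseQuenched

/-!
# Every all-even-sided Dirichlet cell is singular at bare mass `-4`, for every gauge field

Drefute seat `refuter-drefute-stmt-QuantumFields-13995-0` on the crux `EarlyCrosserLaw`
(stmt-QuantumFields-13995), line `accretive-coarse-jensen`; small-model fact found numerically (kit job
j012907: the massless `3⁴`-site Dirichlet cell has the eigenvalue `4` with multiplicity `12` for Haar-random
`SU(3)` links) and proved here in general.

**Theorem** (`det_wilsonCell_neg_four_of_even_sides`).  For every torus side `N`, every `SU(3)` gauge field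
`U`, every corner `x` and all sides `s` with `2 ≤ s_i ≤ N` and every `s_i` EVEN,
`det (wilsonCell U (-4) x s) = 0`.

*Proof (bipartite nullity).*  At bare mass `-4` the diagonal `μ + 4` of the Wilson–Dirac matrix vanishes and
the cell matrix is pure nearest-neighbour hopping; colour the Wilson indices of the box by the parity of the
offset sum `Σ_i (p_i - x_i).val`; a hop inside the box changes that sum by exactly one (`sum_val_shift`, no
wrap-around because `s_i ≤ N`), so entries between equal colours vanish
(`wilsonCell_neg_four_apply_of_parity_eq`).  With all `s_i` even each coordinate ranges over the odd number
`s_i - 1` of offsets `1, …, s_i - 1`, whose signed count `Σ (-1)^o` is `-1` (`sum_coord_sign`); the signed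
count over the box factorises (`sum_sign_wilsonBox`: `12 · (-1)^4 = 12`), so there are twelve more
even-coloured than odd-coloured indices (`card_parity_lt`), and a square matrix that only couples unequal
colours of unequal cardinalities is singular (`det_eq_zero_of_bipartite_of_lt`: the block mapping the larger
colour class into the smaller has a kernel, extended by zero).

**Reading for the crux.**  (i) This EXTENDS the one-site tightness `wilsonCell_two_det_eq_zero_iff`
(`s = (2,2,2,2)`, landed p74201) and corrects the folklore in the crux directory that one-site cells / needles
are the only cells with a gauge-field-independent crossing: every all-even-sided box (one-site cells, `3⁴`,
`5⁴`, `1×3×5×7` sites, …) crosses at `μ' = -4` for every `U`.  (ii) Harmless for `EarlyCrosserLaw` at the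
physical line (`-4 < m_f(k)` as soon as `|m_crit| < 4`), but it means that EVERY leaf size `b₀` admits window
boxes (sides the even number in `{b₀, b₀+1}`) whose parent cell is deterministically singular at `-4`: the
lower pin (b), which keeps `|m_crit| ≤ 8`, and the upper pin / physics, which keep the early segment below `4`,
are what stand between `stub_jensenDilution` and this obstruction at every `b₀` (cf. the companion file
`JensenDilutionWithoutLowerPin`, leaf size `2`).

Standard axioms; no Theses statement is asserted (Negative lane, `--supports stmt-QuantumFields-13995`).
-/

noncomputable section

open Matrix Complex Finset
open Literature.MathematicalPhysics.QuantumLattice Literature.MathematicalPhysics.QuantumFieldTheory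
  Literature.Probability.LatticeModels

namespace Summit.QuantumFields.QCD.Theorems.EarlyCrosserLawNegative

/-! ## Abstract bipartite nullity -/

/-- A square matrix whose entries vanish between indices of EQUAL colour (2-colouring `σ`), with more
`true`-coloured than `false`-coloured indices, is singular. [folklore] -/
theorem det_eq_zero_of_bipartite_of_lt {ι : Type*} [Fintype ι] [DecidableEq ι] (M : Matrix ι ι ℂ)
    (σ : ι → Bool) (hM : ∀ p q, σ p = σ q → M p q = 0)
    (hlt : Fintype.card {p // σ p = false} < Fintype.card {p // σ p = true}) : M.det = 0 := by
  classical
  -- the block `false ← true`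
  set A : Matrix {p // σ p = false} {p // σ p = true} ℂ := fun q p => M q.1 p.1 with hA
  have hker : LinearMap.ker A.mulVecLin ≠ ⊥ := by
    apply LinearMap.ker_ne_bot_of_finrank_lt
    simpa [Module.finrank_fintype_fun_eq_card] using hlt
  obtain ⟨w, hw, hw0⟩ : ∃ w ∈ LinearMap.ker A.mulVecLin, w ≠ 0 := Submodule.exists_mem_ne_zero_of_ne_bot hker
  rw [LinearMap.mem_ker, Matrix.mulVecLin_apply] at hw
  -- extend by zero
  set v : ι → ℂ := fun p => if h : σ p = true then w ⟨p, h⟩ else 0 with hv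
  refine (Matrix.exists_mulVec_eq_zero_iff).mp ⟨v, ?_, ?_⟩
  · intro hv0
    apply hw0
    funext p
    have := congrFun hv0 p.1
    simp only [hv, p.2, dite_true, Pi.zero_apply] at this
    simpa using this
  · funext q
    rw [Pi.zero_apply, Matrix.mulVec, dotProduct]
    by_cases hq : σ q = true
    · refine Finset.sum_eq_zero fun p _ => ?_
      by_cases hp : σ p = true
      · rw [hM q p (hq.trans hp.symm), zero_mul]
      · simp [hv, hp]
    · have hq' : σ q = false := by simpa using hq
      have hAw := congrFun hw ⟨q, hq'⟩
      rw [Pi.zero_apply, Matrix.mulVec, dotProduct] at hAw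
      -- Σ over ι of (zero off `true`) = Σ over the subtype
      have hsum : ∑ p, M q p * v p = ∑ p : {p // σ p = true}, M q p.1 * w p := by
        have h1 : ∑ p, M q p * v p = ∑ p ∈ univ.filter (fun p => σ p = true), M q p * v p := by
          rw [Finset.sum_filter]
          refine Finset.sum_congr rfl fun p _ => ?_
          by_cases hp : σ p = true
          · rw [if_pos hp]
          · rw [if_neg hp]
            simp [hv, hp]
        rw [h1, Finset.sum_subtype (univ.filter fun p => σ p = true) (p := fun p => σ p = true) (by simp)]
        refine Finset.sum_congr rfl fun p _ => ?_
        simp [hv, p.2]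
      rw [hsum, ← hAw]

/-! ## Offset parity on a box; the hopping couples opposite parities only -/

section Cell

variable {N : ℕ} [NeZero N]

/-- Local notation: the colour group `SU(3)`. -/
local notation "𝔾" => Matrix.specialUnitaryGroup (Fin 3) ℂ

/-- A hop inside the box raises the offset sum by exactly one (no wrap-around, `s i ≤ N`). [folklore] -/
theorem sum_val_shift {x : TorusSite 4 N} {s : Fin 4 → ℕ} (hs : ∀ i, s i ≤ N)
    {y : TorusSite 4 N} (hy : siteBox x s y) (μ : Fin 4)
    (hy' : siteBox x s (Literature.MathematicalPhysics.QuantumFieldTheory.Site.shift y μ)) :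
    (∑ i, (Literature.MathematicalPhysics.QuantumFieldTheory.Site.shift y μ i - x i).val) = (∑ i, (y i - x i).val) + 1 := by
  have hval : ∀ i, (Literature.MathematicalPhysics.QuantumFieldTheory.Site.shift y μ i - x i).val = (y i - x i).val + if i = μ then 1 else 0 := by
    intro i
    by_cases hi : i = μ
    · subst hi
      rw [if_pos rfl]
      have hshift : Literature.MathematicalPhysics.QuantumFieldTheory.Site.shift y i i - x i = (y i - x i) + 1 := by
        simp [Literature.MathematicalPhysics.QuantumFieldTheory.Site.shift]
        ring
      rw [hshift]
      have hlt : (y i - x i).val < N := ZMod.val_lt _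
      have hpos : 0 < (y i - x i).val := (hy i).1
      have hN : 1 < N := by have := (hy i).2; have := hs i; omega
      haveI : Fact (1 < N) := ⟨hN⟩
      by_cases hwrap : (y i - x i).val + 1 < N
      · rw [ZMod.val_add_of_lt (by rwa [ZMod.val_one]), ZMod.val_one]
      · exfalso
        have hle : N ≤ (y i - x i).val + (1 : ZMod N).val := by rw [ZMod.val_one]; omega
        have h := ZMod.val_add_val_of_le hle
        rw [ZMod.val_one] at h
        have h0 : (y i - x i + 1).val = 0 := by omega
        have hpos' := (hy' i).1
        rw [hshift, h0] at hpos'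
        exact lt_irrefl _ hpos'
    · rw [if_neg hi, add_zero]
      have : Literature.MathematicalPhysics.QuantumFieldTheory.Site.shift y μ i = y i := by simp [Literature.MathematicalPhysics.QuantumFieldTheory.Site.shift, hi]
      rw [this]
  simp_rw [hval]
  rw [Finset.sum_add_distrib, Finset.sum_ite_eq' Finset.univ μ, if_pos (Finset.mem_univ μ)]

/-- **The massless hopping couples opposite offset parities only**: at bare mass `-4` (zero diagonal) every
entry of the Dirichlet cell matrix between Wilson indices of equal offset parity vanishes. [folklore] -/
theorem wilsonCell_neg_four_apply_of_parity_eq (U : GaugeConfig 4 N 𝔾) (x : TorusSite 4 N)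
    (s : Fin 4 → ℕ) (hs : ∀ i, s i ≤ N) (p q : {p // wilsonBox x s p})
    (hpq : decide (Even (∑ i, ((p : TorusSite 4 N × Fin 3 × Fin 4).1 i - x i).val)) =
      decide (Even (∑ i, ((q : TorusSite 4 N × Fin 3 × Fin 4).1 i - x i).val))) :
    wilsonCell U (-4) x s p q = 0 := by
  have hp : siteBox x s (p : TorusSite 4 N × Fin 3 × Fin 4).1 := p.2
  have hq : siteBox x s (q : TorusSite 4 N × Fin 3 × Fin 4).1 := q.2
  have hpq' : Even (∑ i, ((p : TorusSite 4 N × Fin 3 × Fin 4).1 i - x i).val) ↔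
      Even (∑ i, ((q : TorusSite 4 N × Fin 3 × Fin 4).1 i - x i).val) := by
    simpa using hpq
  have hns : ∀ μ, ¬ ((q : TorusSite 4 N × Fin 3 × Fin 4).1 =
      Literature.MathematicalPhysics.QuantumFieldTheory.Site.shift (p : TorusSite 4 N × Fin 3 × Fin 4).1 μ) := by
    intro μ h
    have hq'' : siteBox x s (Literature.MathematicalPhysics.QuantumFieldTheory.Site.shift (p : TorusSite 4 N × Fin 3 × Fin 4).1 μ) := h ▸ hq
    have hsum := sum_val_shift hs hp μ hq''
    rw [← h] at hsum
    rw [hsum, Nat.even_add_one] at hpq'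
    exact (not_iff_self hpq'.symm).elim
  have hns' : ∀ μ, ¬ ((p : TorusSite 4 N × Fin 3 × Fin 4).1 =
      Literature.MathematicalPhysics.QuantumFieldTheory.Site.shift (q : TorusSite 4 N × Fin 3 × Fin 4).1 μ) := by
    intro μ h
    have hp'' : siteBox x s (Literature.MathematicalPhysics.QuantumFieldTheory.Site.shift (q : TorusSite 4 N × Fin 3 × Fin 4).1 μ) := h ▸ hp
    have hsum := sum_val_shift hs hq μ hp''
    rw [← h] at hsum
    rw [hsum, Nat.even_add_one] at hpq'
    exact (not_iff_self hpq').elim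
  simp only [wilsonCell, Matrix.toSquareBlockProp_def, Matrix.of_apply, wilsonDirac]
  simp only [hns, hns', if_false, add_zero, Finset.sum_const_zero, mul_zero, sub_zero]
  split_ifs
  · push_cast; ring
  · rfl

/-! ## Counting: one more even-parity than odd-parity Wilson index when all sides are even -/

/-- `Σ_{k < 2m+2, k > 0} (-1)^k = -1`. [folklore] -/
theorem sum_range_ite_neg_one_pow (m : ℕ) :
    ∑ k ∈ Finset.range (2 * m + 2), (if 0 < k then (-1 : ℤ) ^ k else 0) = -1 := by
  induction m with
  | zero => simp [Finset.sum_range_succ]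
  | succ m ih =>
    rw [show 2 * (m + 1) + 2 = (2 * m + 2) + 1 + 1 by ring, Finset.sum_range_succ, Finset.sum_range_succ, ih]
    have h1 : (0 : ℕ) < 2 * m + 2 := by omega
    have h2 : (0 : ℕ) < 2 * m + 2 + 1 := by omega
    rw [if_pos h1, if_pos h2]
    have e1 : (-1 : ℤ) ^ (2 * m + 2) = 1 := by
      rw [show 2 * m + 2 = 2 * (m + 1) by ring, pow_mul]
      simp
    have e2 : (-1 : ℤ) ^ (2 * m + 2 + 1) = -1 := by rw [pow_succ, e1]; simp
    rw [e1, e2]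
    ring

omit [NeZero N] in
/-- Sums over `ZMod N` through `val` are sums over `range N`. [folklore] -/
theorem sum_zmod_val [NeZero N] (H : ℕ → ℤ) : ∑ w : ZMod N, H w.val = ∑ k ∈ Finset.range N, H k := by
  obtain ⟨n, hn⟩ := Nat.exists_eq_succ_of_ne_zero (NeZero.ne N)
  subst hn
  exact Fin.sum_univ_eq_sum_range H (n + 1)

/-- The signed offset count of one coordinate of an even-sided box is `-1`. [folklore] -/
theorem sum_coord_sign (c : ZMod N) {t : ℕ} (htN : t ≤ N) (heven : Even t) (ht2 : 2 ≤ t) :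
    ∑ z : ZMod N, (if 0 < (z - c).val ∧ (z - c).val < t then (-1 : ℤ) ^ (z - c).val else 0) = -1 := by
  have h1 : ∑ z : ZMod N, (if 0 < (z - c).val ∧ (z - c).val < t then (-1 : ℤ) ^ (z - c).val else 0)
      = ∑ w : ZMod N, (if 0 < w.val ∧ w.val < t then (-1 : ℤ) ^ w.val else 0) :=
    (Equiv.subRight c).sum_comp (fun w => if 0 < w.val ∧ w.val < t then (-1 : ℤ) ^ w.val else 0)
  rw [h1, sum_zmod_val (fun k => if 0 < k ∧ k < t then (-1 : ℤ) ^ k else 0)]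
  have h2 : ∑ k ∈ Finset.range N, (if 0 < k ∧ k < t then (-1 : ℤ) ^ k else 0)
      = ∑ k ∈ Finset.range t, (if 0 < k then (-1 : ℤ) ^ k else 0) := by
    rw [← Finset.sum_filter, ← Finset.sum_filter]
    congr 1
    ext k
    simp only [Finset.mem_filter, Finset.mem_range]
    omega
  rw [h2]
  obtain ⟨m', rfl⟩ : ∃ m', t = 2 * m' + 2 := by
    obtain ⟨m, hm⟩ := heven
    exact ⟨m - 1, by omega⟩
  exact sum_range_ite_neg_one_pow m'

/-- **The parity imbalance.**  On a box with all sides even (`2 ≤ s_i ≤ N`), the signed count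
`Σ_p (-1)^{offset sum}` over the Wilson indices of the box equals `12`. [folklore] -/
theorem sum_sign_wilsonBox (x : TorusSite 4 N) (s : Fin 4 → ℕ) (hs : ∀ i, s i ≤ N)
    (h2 : ∀ i, 2 ≤ s i) (heven : ∀ i, Even (s i)) :
    ∑ p : {p // wilsonBox x s p}, (-1 : ℤ) ^ (∑ i, ((p : TorusSite 4 N × Fin 3 × Fin 4).1 i - x i).val) = 12 := by
  classical
  -- to an indicator sum over all Wilson indices
  have hA : ∑ p : {p // wilsonBox x s p}, (-1 : ℤ) ^ (∑ i, ((p : TorusSite 4 N × Fin 3 × Fin 4).1 i - x i).val)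
      = ∑ p : TorusSite 4 N × Fin 3 × Fin 4,
          (if wilsonBox x s p then (-1 : ℤ) ^ (∑ i, (p.1 i - x i).val) else 0) := by
    rw [← Finset.sum_filter]
    exact (Finset.sum_subtype (Finset.univ.filter (wilsonBox x s)) (by simp)
      (fun p : TorusSite 4 N × Fin 3 × Fin 4 => (-1 : ℤ) ^ (∑ i, (p.1 i - x i).val))).symm
  -- strip the twelve internal components
  have hB : ∑ p : TorusSite 4 N × Fin 3 × Fin 4,
        (if wilsonBox x s p then (-1 : ℤ) ^ (∑ i, (p.1 i - x i).val) else 0)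
      = 12 * ∑ y : TorusSite 4 N, (if siteBox x s y then (-1 : ℤ) ^ (∑ i, (y i - x i).val) else 0) := by
    rw [Fintype.sum_prod_type, Finset.mul_sum]
    refine Finset.sum_congr rfl fun y _ => ?_
    simp only [wilsonBox_iff]
    rw [Finset.sum_const, Finset.card_univ, Fintype.card_prod, Fintype.card_fin, Fintype.card_fin]
    simp
  -- factorise the indicator over the four coordinates
  have hC : ∀ y : TorusSite 4 N, (if siteBox x s y then (-1 : ℤ) ^ (∑ i, (y i - x i).val) else 0)
      = ∏ i, (if 0 < (y i - x i).val ∧ (y i - x i).val < s i then (-1 : ℤ) ^ (y i - x i).val else 0) := by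
    intro y
    by_cases hy : siteBox x s y
    · rw [if_pos hy, ← Finset.prod_pow_eq_pow_sum]
      exact Finset.prod_congr rfl fun i _ => (if_pos (hy i)).symm
    · rw [if_neg hy]
      obtain ⟨i, hi⟩ : ∃ i, ¬ (0 < (y i - x i).val ∧ (y i - x i).val < s i) := by
        simpa [siteBox] using hy
      exact (Finset.prod_eq_zero (Finset.mem_univ i) (if_neg hi)).symm
  -- sum of products = product of sums; each factor is `-1`
  have hD : ∑ y : TorusSite 4 N,
        ∏ i, (if 0 < (y i - x i).val ∧ (y i - x i).val < s i then (-1 : ℤ) ^ (y i - x i).val else 0)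
      = ∏ i : Fin 4, ∑ z : ZMod N,
          (if 0 < (z - x i).val ∧ (z - x i).val < s i then (-1 : ℤ) ^ (z - x i).val else 0) := by
    rw [Finset.prod_univ_sum]
    simp only [Fintype.piFinset_univ]
  rw [hA, hB]
  simp_rw [hC]
  rw [hD]
  have hE : ∀ i : Fin 4, ∑ z : ZMod N,
      (if 0 < (z - x i).val ∧ (z - x i).val < s i then (-1 : ℤ) ^ (z - x i).val else 0) = -1 :=
    fun i => sum_coord_sign (x i) (hs i) (heven i) (h2 i)
  simp only [hE]
  norm_num [Fin.prod_const]

/-- **More even than odd**: the offset-parity colouring of an all-even-sided box has twelve more `even`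
than `odd` Wilson indices, in particular strictly more. [folklore] -/
theorem card_parity_lt (x : TorusSite 4 N) (s : Fin 4 → ℕ) (hs : ∀ i, s i ≤ N)
    (h2 : ∀ i, 2 ≤ s i) (heven : ∀ i, Even (s i)) :
    Fintype.card {p : {p // wilsonBox x s p} //
        decide (Even (∑ i, ((p : TorusSite 4 N × Fin 3 × Fin 4).1 i - x i).val)) = false} <
      Fintype.card {p : {p // wilsonBox x s p} //
        decide (Even (∑ i, ((p : TorusSite 4 N × Fin 3 × Fin 4).1 i - x i).val)) = true} := by
  classical
  have hsum := sum_sign_wilsonBox x s hs h2 heven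
  have hsplit : ∑ p : {p // wilsonBox x s p},
      (-1 : ℤ) ^ (∑ i, ((p : TorusSite 4 N × Fin 3 × Fin 4).1 i - x i).val)
      = (Fintype.card {p : {p // wilsonBox x s p} //
          decide (Even (∑ i, ((p : TorusSite 4 N × Fin 3 × Fin 4).1 i - x i).val)) = true} : ℤ)
        - Fintype.card {p : {p // wilsonBox x s p} //
          decide (Even (∑ i, ((p : TorusSite 4 N × Fin 3 × Fin 4).1 i - x i).val)) = false} := by
    have hpt : ∀ p : {p // wilsonBox x s p},
        (-1 : ℤ) ^ (∑ i, ((p : TorusSite 4 N × Fin 3 × Fin 4).1 i - x i).val)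
        = if Even (∑ i, ((p : TorusSite 4 N × Fin 3 × Fin 4).1 i - x i).val) then 1 else -1 := by
      intro p
      split_ifs with h
      · exact h.neg_one_pow
      · exact (Nat.not_even_iff_odd.mp h).neg_one_pow
    simp_rw [hpt]
    rw [Finset.sum_ite, Finset.sum_const, Finset.sum_const, nsmul_eq_mul, nsmul_eq_mul,
      Fintype.card_subtype, Fintype.card_subtype]
    simp only [decide_eq_true_eq, decide_eq_false_iff_not, mul_one, mul_neg_one]
    ring
  rw [hsplit] at hsum
  omega

/-- **Every Dirichlet cell with all sides even is singular at bare mass `-4`, for EVERY gauge field**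
(bipartite nullity of the massless hopping: the kernel of `D_c(-4) = -(hopping)` has dimension `≥ 12`).
This extends the one-site tightness `wilsonCell_two_det_eq_zero_iff` (sides `(2,2,2,2)`) to all boxes with
`2 ≤ s_i ≤ N`, `s_i` even: a gauge-field-independent crossing at `μ' = -4` — harmless for the crux at the
physical line (`-4 < m_f(k)`), lethal for `stub_jensenDilution` once the lower pin is dropped (every leaf
size `b₀` admits an all-even window box). [folklore] -/
theorem det_wilsonCell_neg_four_of_even_sides (U : GaugeConfig 4 N (Matrix.specialUnitaryGroup (Fin 3) ℂ))
    (x : TorusSite 4 N) (s : Fin 4 → ℕ) (hs : ∀ i, s i ≤ N) (h2 : ∀ i, 2 ≤ s i) (heven : ∀ i, Even (s i)) :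
    (wilsonCell U (-4) x s).det = 0 := by
  classical
  exact det_eq_zero_of_bipartite_of_lt _
    (fun p => decide (Even (∑ i, ((p : TorusSite 4 N × Fin 3 × Fin 4).1 i - x i).val)))
    (fun p q hpq => wilsonCell_neg_four_apply_of_parity_eq U x s hs p q hpq)
    (card_parity_lt x s hs h2 heven)

end Cell

end Summit.QuantumFields.QCD.Theorems.EarlyCrosserLawNegative

end
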